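import Summits.ABC.IUTFork.Conditional.FreyHullThresholdGenuineWildUnitExact
import Summits.ABC.IUTFork.Conditional.AbcOfSGenuineKLinUniformRows6
import HarnessLib

/-!
# R-W «W:REF-BANDS-WILD-EXACT» — the 5¹¹·31·191-triple at its W2 pole `p = 3`: S_H FAILS at EVERY genuine Θ-volume datum over
# `(ratPoint (a/c), l)` for EVERY prime `5 ≤ l ≤ 956537` — ONE band theorem (desk band 178,754 with Dedekind's `δ` → 956,537 with the EXACT W2 `δ`)

PROOF-ONLY file (no `def`, no new `Prop`, no instance) of the abc-iut cell (rung LADDER-ABC:A2.RESCUE.W; seat abc-iut-w5-d180 gen 10, row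
«W:REF-BANDS-WILD-EXACT», plan C-R88 (a)(ii); desk HOME/staging/w5/w5-d180/g10/REF-BANDS-WILD-EXACT.txt d92cbf25b0c753df). TAKES NO SIDE on [IUTchIII]
Cor. 3.12 or on any author.

The triple `5¹¹·31·191 + 2⁸·7¹³·89·859² = 3³⁰·13⁴·277` (the tree's `isABCTriple_frey289111328125`) has a pole of `j(a/c)` of order `2t = 60` at `p = 3` with
`3 ∣ t` and the W2 unit test `3 ∣ D`, `9 ∤ D` (`D = ((abc/3³⁰)²)² − (2⁸(cb + a²)³)²`, 260 digits; `norm_num`), so every completion `K_{x₀}`, `x₀ ∣ 3`, of every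
genuine datum over `(ratPoint (a/c), l)` (`l ≠ 3`) has `e = 6·l` and the EXACT different `d = (8·l − 1)/(6·l)` (abc-iut-W-neg-1's type + abc-iut-w5-d180's
`GenuineK.differentOrd_kOf_eq_wildUnit_ratPoint`; Dedekind's bound gives only `(12l − 1)/(6l)`). The W2 engine's `δ`-cell
(`GenuineK.not_pilotKummerCompatHull_chosen_triple_of_wildUnitCell`, p496468) at the TOP label, in `l = 2k + 3`, is ONE integer polynomial inequality per
turning-point piece `a₀ = 3, …, 14` (`l ≤ 3^{a₀−1}`): `R(k) − L(k) = (158 − 12a₀)k² + (3^{a₀} − 97 − 18a₀)k + (3^{a₀} − 304 − 12a₀) ≥ 0`, all pieces convex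
with positive values except the last (`a₀ = 14`: `−10k² + 4782668k + 9565373 ≥ 0 ⟺ k ≤ 478268`, i.e. `l ≤ 956539`): the band ENDS at the prime `956537`.
The integer division of the engine's cell is removed by `e·⌊X/e⌋ > X − e`. One private lemma per piece keeps every declaration under the default heartbeats.

* `WildUnitCells.frey289111328125_three_band` — the cell table, symbolic in `l` (twelve pieces);
* **`GenuineK.not_pilotKummerCompatHull_chosen_frey289111328125_three_band`** — for EVERY prime `5 ≤ l ≤ 956537` and EVERY genuine Θ-volume datum `T`
  over `(ratPoint (5¹¹·31·191 / 3³⁰13⁴277), l)`: the hull-level clause S_H (`Cor312Vol.PilotKummerCompatHull`, chosen realising ideles, pinned reading)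
  FAILS for every choice of the free context binders and Kummer data — every prime below 956,538 (about 75,000 of them) in ONE theorem.

NOT claimed: admissibility / Szpiro-badness / (P6) of `(ratPoint (a/c), l)` at these `l`, non-emptiness of the datum type; «refuted as typed» ≠
«refuted in print»; nothing about the number-level Corollary; typed ≠ proved; instantiated ≠ endorsed; no abc claim.
[cite: Mochizuki2012, IUTchIII Cor. 3.12 Step (xi-f) p. 184; IUTchIV Prop. 1.2 (i)(ii) p. 10, Prop. 1.3 (i) p. 11, Cor. 2.2 (ii) proof p. 44]
[cite: SerreLocalFields1979, Ch. III §6 Prop. 13] [cite: Serre1973, Ch. II §3.3] [claim: Mochizuki2012, status: disputed] for every IUT sentence quoted.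
-/

noncomputable section

open Set Function NumberField IsDedekindDomain

namespace Summit.ABC.IUTFork.Conditional

open Thm311 Thm311.Real Cor312 Cor312Vol Cor312Prov Literature.IUT.LogThetaLattice Literature.IUT.LogVolume
  Literature.IUT.HodgeTheaters Literature.IUT.LogVolume.ThetaData
  Literature.NumberTheory.NumberFields Literature.NumberTheory.DiophantineGeometry.GenEll
  Literature.NumberTheory.DiophantineGeometry Summit.ABC.ABC.Theorems

/-! ## §0. Removing the integer division of the cell -/

/-- `L + d ≤ X ⇒ L < d·⌊X/d⌋` for `d > 0` (`d·⌊X/d⌋ = X − (X mod d) > X − d`). [folklore] -/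
private theorem lt_mul_ediv_of_add_le' {L X d : ℤ} (hd : 0 < d) (h : L + d ≤ X) : L < d * (X / d) := by
  have h1 := Int.mul_ediv_add_emod X d
  have h2 := Int.emod_lt_of_pos X hd
  have h3 := Int.emod_nonneg X hd.ne'
  linarith

/-! ## §1. The cell of the 5¹¹·31·191-triple at `p = 3` (W2, `A = 6`, `e = 6l = 12k + 18`, `δ = 8l − 1 = 16k + 23`, `r_in = 3l + 1 = 6k + 10`,
`P_q = 180`, top label `i + 1 = k + 1`), one lemma per turning-point piece `a₀` -/

/-- Piece `a₀ = 3` (`5 ≤ l ≤ 9`, `l = 2k + 3`) of the cell table below. [cite: Mochizuki2012, IUTchIV Prop. 1.2 (i)(ii) p. 10] -/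
private theorem WildUnitCells.p191_3 (k : ℕ) (hlo : 1 ≤ k) (hhi : k ≤ 3) :
    (∀ a, a < 3 → (1 : ℤ) * ((3 : ℕ) : ℤ) ^ a * (((3 : ℕ) : ℤ) - 1) < ((12 * k + 18 : ℕ) : ℤ)) ∧
      ((12 * k + 18 : ℕ) : ℤ) ≤ 1 * ((3 : ℕ) : ℤ) ^ (3 : ℕ) * (((3 : ℕ) : ℤ) - 1) ∧
      ((6 * 30 : ℕ) : ℤ) - (((k : ℕ) : ℤ) + 1 + 1) * (((3 : ℕ) : ℤ) ^ (3 : ℕ) - ((3 : ℕ) : ℤ) * ((12 * k + 18 : ℕ) : ℤ)) <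
        ((12 * k + 18 : ℕ) : ℤ) * (((((k : ℕ) : ℤ) + 1) ^ 2 * ((6 * 30 : ℕ) : ℤ) - (((k : ℕ) : ℤ) + 1) * ((16 * k + 23 : ℕ) : ℤ)
          - (((k : ℕ) : ℤ) + 1 + 1) * ((6 * k + 10 : ℕ) : ℤ)) / ((12 * k + 18 : ℕ) : ℤ)) := by
  have hlo' : (1 : ℤ) ≤ (k : ℤ) := by exact_mod_cast hlo
  have hhi' : (k : ℤ) ≤ 3 := by exact_mod_cast hhi
  refine ⟨fun a ha => ?_, ?_, lt_mul_ediv_of_add_le' (by positivity) ?_⟩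
  · have h3 : (3 : ℤ) ^ a ≤ 3 ^ (3 - 1) := pow_le_pow_right₀ (by norm_num) (by omega)
    push_cast; norm_num at h3 ⊢; nlinarith [h3]
  · push_cast; nlinarith
  · push_cast; nlinarith [mul_nonneg (sub_nonneg.2 hlo') (by positivity : (0 : ℤ) ≤ (k : ℤ))]

/-- Piece `a₀ = 4` (`11 ≤ l ≤ 27`, `l = 2k + 3`) of the cell table below. [cite: Mochizuki2012, IUTchIV Prop. 1.2 (i)(ii) p. 10] -/
private theorem WildUnitCells.p191_4 (k : ℕ) (hlo : 4 ≤ k) (hhi : k ≤ 12) :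
    (∀ a, a < 4 → (1 : ℤ) * ((3 : ℕ) : ℤ) ^ a * (((3 : ℕ) : ℤ) - 1) < ((12 * k + 18 : ℕ) : ℤ)) ∧
      ((12 * k + 18 : ℕ) : ℤ) ≤ 1 * ((3 : ℕ) : ℤ) ^ (4 : ℕ) * (((3 : ℕ) : ℤ) - 1) ∧
      ((6 * 30 : ℕ) : ℤ) - (((k : ℕ) : ℤ) + 1 + 1) * (((3 : ℕ) : ℤ) ^ (4 : ℕ) - ((4 : ℕ) : ℤ) * ((12 * k + 18 : ℕ) : ℤ)) <
        ((12 * k + 18 : ℕ) : ℤ) * (((((k : ℕ) : ℤ) + 1) ^ 2 * ((6 * 30 : ℕ) : ℤ) - (((k : ℕ) : ℤ) + 1) * ((16 * k + 23 : ℕ) : ℤ)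
          - (((k : ℕ) : ℤ) + 1 + 1) * ((6 * k + 10 : ℕ) : ℤ)) / ((12 * k + 18 : ℕ) : ℤ)) := by
  have hlo' : (4 : ℤ) ≤ (k : ℤ) := by exact_mod_cast hlo
  have hhi' : (k : ℤ) ≤ 12 := by exact_mod_cast hhi
  refine ⟨fun a ha => ?_, ?_, lt_mul_ediv_of_add_le' (by positivity) ?_⟩
  · have h3 : (3 : ℤ) ^ a ≤ 3 ^ (4 - 1) := pow_le_pow_right₀ (by norm_num) (by omega)
    push_cast; norm_num at h3 ⊢; nlinarith [h3]
  · push_cast; nlinarith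
  · push_cast; nlinarith [mul_nonneg (sub_nonneg.2 hlo') (by positivity : (0 : ℤ) ≤ (k : ℤ))]

/-- Piece `a₀ = 5` (`29 ≤ l ≤ 81`, `l = 2k + 3`) of the cell table below. [cite: Mochizuki2012, IUTchIV Prop. 1.2 (i)(ii) p. 10] -/
private theorem WildUnitCells.p191_5 (k : ℕ) (hlo : 13 ≤ k) (hhi : k ≤ 39) :
    (∀ a, a < 5 → (1 : ℤ) * ((3 : ℕ) : ℤ) ^ a * (((3 : ℕ) : ℤ) - 1) < ((12 * k + 18 : ℕ) : ℤ)) ∧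
      ((12 * k + 18 : ℕ) : ℤ) ≤ 1 * ((3 : ℕ) : ℤ) ^ (5 : ℕ) * (((3 : ℕ) : ℤ) - 1) ∧
      ((6 * 30 : ℕ) : ℤ) - (((k : ℕ) : ℤ) + 1 + 1) * (((3 : ℕ) : ℤ) ^ (5 : ℕ) - ((5 : ℕ) : ℤ) * ((12 * k + 18 : ℕ) : ℤ)) <
        ((12 * k + 18 : ℕ) : ℤ) * (((((k : ℕ) : ℤ) + 1) ^ 2 * ((6 * 30 : ℕ) : ℤ) - (((k : ℕ) : ℤ) + 1) * ((16 * k + 23 : ℕ) : ℤ)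
          - (((k : ℕ) : ℤ) + 1 + 1) * ((6 * k + 10 : ℕ) : ℤ)) / ((12 * k + 18 : ℕ) : ℤ)) := by
  have hlo' : (13 : ℤ) ≤ (k : ℤ) := by exact_mod_cast hlo
  have hhi' : (k : ℤ) ≤ 39 := by exact_mod_cast hhi
  refine ⟨fun a ha => ?_, ?_, lt_mul_ediv_of_add_le' (by positivity) ?_⟩
  · have h3 : (3 : ℤ) ^ a ≤ 3 ^ (5 - 1) := pow_le_pow_right₀ (by norm_num) (by omega)
    push_cast; norm_num at h3 ⊢; nlinarith [h3]
  · push_cast; nlinarith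
  · push_cast; nlinarith [mul_nonneg (sub_nonneg.2 hlo') (by positivity : (0 : ℤ) ≤ (k : ℤ))]

/-- Piece `a₀ = 6` (`83 ≤ l ≤ 243`, `l = 2k + 3`) of the cell table below. [cite: Mochizuki2012, IUTchIV Prop. 1.2 (i)(ii) p. 10] -/
private theorem WildUnitCells.p191_6 (k : ℕ) (hlo : 40 ≤ k) (hhi : k ≤ 120) :
    (∀ a, a < 6 → (1 : ℤ) * ((3 : ℕ) : ℤ) ^ a * (((3 : ℕ) : ℤ) - 1) < ((12 * k + 18 : ℕ) : ℤ)) ∧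
      ((12 * k + 18 : ℕ) : ℤ) ≤ 1 * ((3 : ℕ) : ℤ) ^ (6 : ℕ) * (((3 : ℕ) : ℤ) - 1) ∧
      ((6 * 30 : ℕ) : ℤ) - (((k : ℕ) : ℤ) + 1 + 1) * (((3 : ℕ) : ℤ) ^ (6 : ℕ) - ((6 : ℕ) : ℤ) * ((12 * k + 18 : ℕ) : ℤ)) <
        ((12 * k + 18 : ℕ) : ℤ) * (((((k : ℕ) : ℤ) + 1) ^ 2 * ((6 * 30 : ℕ) : ℤ) - (((k : ℕ) : ℤ) + 1) * ((16 * k + 23 : ℕ) : ℤ)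
          - (((k : ℕ) : ℤ) + 1 + 1) * ((6 * k + 10 : ℕ) : ℤ)) / ((12 * k + 18 : ℕ) : ℤ)) := by
  have hlo' : (40 : ℤ) ≤ (k : ℤ) := by exact_mod_cast hlo
  have hhi' : (k : ℤ) ≤ 120 := by exact_mod_cast hhi
  refine ⟨fun a ha => ?_, ?_, lt_mul_ediv_of_add_le' (by positivity) ?_⟩
  · have h3 : (3 : ℤ) ^ a ≤ 3 ^ (6 - 1) := pow_le_pow_right₀ (by norm_num) (by omega)
    push_cast; norm_num at h3 ⊢; nlinarith [h3]
  · push_cast; nlinarith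
  · push_cast; nlinarith [mul_nonneg (sub_nonneg.2 hlo') (by positivity : (0 : ℤ) ≤ (k : ℤ))]

/-- Piece `a₀ = 7` (`245 ≤ l ≤ 729`, `l = 2k + 3`) of the cell table below. [cite: Mochizuki2012, IUTchIV Prop. 1.2 (i)(ii) p. 10] -/
private theorem WildUnitCells.p191_7 (k : ℕ) (hlo : 121 ≤ k) (hhi : k ≤ 363) :
    (∀ a, a < 7 → (1 : ℤ) * ((3 : ℕ) : ℤ) ^ a * (((3 : ℕ) : ℤ) - 1) < ((12 * k + 18 : ℕ) : ℤ)) ∧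
      ((12 * k + 18 : ℕ) : ℤ) ≤ 1 * ((3 : ℕ) : ℤ) ^ (7 : ℕ) * (((3 : ℕ) : ℤ) - 1) ∧
      ((6 * 30 : ℕ) : ℤ) - (((k : ℕ) : ℤ) + 1 + 1) * (((3 : ℕ) : ℤ) ^ (7 : ℕ) - ((7 : ℕ) : ℤ) * ((12 * k + 18 : ℕ) : ℤ)) <
        ((12 * k + 18 : ℕ) : ℤ) * (((((k : ℕ) : ℤ) + 1) ^ 2 * ((6 * 30 : ℕ) : ℤ) - (((k : ℕ) : ℤ) + 1) * ((16 * k + 23 : ℕ) : ℤ)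
          - (((k : ℕ) : ℤ) + 1 + 1) * ((6 * k + 10 : ℕ) : ℤ)) / ((12 * k + 18 : ℕ) : ℤ)) := by
  have hlo' : (121 : ℤ) ≤ (k : ℤ) := by exact_mod_cast hlo
  have hhi' : (k : ℤ) ≤ 363 := by exact_mod_cast hhi
  refine ⟨fun a ha => ?_, ?_, lt_mul_ediv_of_add_le' (by positivity) ?_⟩
  · have h3 : (3 : ℤ) ^ a ≤ 3 ^ (7 - 1) := pow_le_pow_right₀ (by norm_num) (by omega)
    push_cast; norm_num at h3 ⊢; nlinarith [h3]
  · push_cast; nlinarith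
  · push_cast; nlinarith [mul_nonneg (sub_nonneg.2 hlo') (by positivity : (0 : ℤ) ≤ (k : ℤ))]

/-- Piece `a₀ = 8` (`731 ≤ l ≤ 2187`, `l = 2k + 3`) of the cell table below. [cite: Mochizuki2012, IUTchIV Prop. 1.2 (i)(ii) p. 10] -/
private theorem WildUnitCells.p191_8 (k : ℕ) (hlo : 364 ≤ k) (hhi : k ≤ 1092) :
    (∀ a, a < 8 → (1 : ℤ) * ((3 : ℕ) : ℤ) ^ a * (((3 : ℕ) : ℤ) - 1) < ((12 * k + 18 : ℕ) : ℤ)) ∧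
      ((12 * k + 18 : ℕ) : ℤ) ≤ 1 * ((3 : ℕ) : ℤ) ^ (8 : ℕ) * (((3 : ℕ) : ℤ) - 1) ∧
      ((6 * 30 : ℕ) : ℤ) - (((k : ℕ) : ℤ) + 1 + 1) * (((3 : ℕ) : ℤ) ^ (8 : ℕ) - ((8 : ℕ) : ℤ) * ((12 * k + 18 : ℕ) : ℤ)) <
        ((12 * k + 18 : ℕ) : ℤ) * (((((k : ℕ) : ℤ) + 1) ^ 2 * ((6 * 30 : ℕ) : ℤ) - (((k : ℕ) : ℤ) + 1) * ((16 * k + 23 : ℕ) : ℤ)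
          - (((k : ℕ) : ℤ) + 1 + 1) * ((6 * k + 10 : ℕ) : ℤ)) / ((12 * k + 18 : ℕ) : ℤ)) := by
  have hlo' : (364 : ℤ) ≤ (k : ℤ) := by exact_mod_cast hlo
  have hhi' : (k : ℤ) ≤ 1092 := by exact_mod_cast hhi
  refine ⟨fun a ha => ?_, ?_, lt_mul_ediv_of_add_le' (by positivity) ?_⟩
  · have h3 : (3 : ℤ) ^ a ≤ 3 ^ (8 - 1) := pow_le_pow_right₀ (by norm_num) (by omega)
    push_cast; norm_num at h3 ⊢; nlinarith [h3]
  · push_cast; nlinarith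
  · push_cast; nlinarith [mul_nonneg (sub_nonneg.2 hlo') (by positivity : (0 : ℤ) ≤ (k : ℤ))]

/-- Piece `a₀ = 9` (`2189 ≤ l ≤ 6561`, `l = 2k + 3`) of the cell table below. [cite: Mochizuki2012, IUTchIV Prop. 1.2 (i)(ii) p. 10] -/
private theorem WildUnitCells.p191_9 (k : ℕ) (hlo : 1093 ≤ k) (hhi : k ≤ 3279) :
    (∀ a, a < 9 → (1 : ℤ) * ((3 : ℕ) : ℤ) ^ a * (((3 : ℕ) : ℤ) - 1) < ((12 * k + 18 : ℕ) : ℤ)) ∧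
      ((12 * k + 18 : ℕ) : ℤ) ≤ 1 * ((3 : ℕ) : ℤ) ^ (9 : ℕ) * (((3 : ℕ) : ℤ) - 1) ∧
      ((6 * 30 : ℕ) : ℤ) - (((k : ℕ) : ℤ) + 1 + 1) * (((3 : ℕ) : ℤ) ^ (9 : ℕ) - ((9 : ℕ) : ℤ) * ((12 * k + 18 : ℕ) : ℤ)) <
        ((12 * k + 18 : ℕ) : ℤ) * (((((k : ℕ) : ℤ) + 1) ^ 2 * ((6 * 30 : ℕ) : ℤ) - (((k : ℕ) : ℤ) + 1) * ((16 * k + 23 : ℕ) : ℤ)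
          - (((k : ℕ) : ℤ) + 1 + 1) * ((6 * k + 10 : ℕ) : ℤ)) / ((12 * k + 18 : ℕ) : ℤ)) := by
  have hlo' : (1093 : ℤ) ≤ (k : ℤ) := by exact_mod_cast hlo
  have hhi' : (k : ℤ) ≤ 3279 := by exact_mod_cast hhi
  refine ⟨fun a ha => ?_, ?_, lt_mul_ediv_of_add_le' (by positivity) ?_⟩
  · have h3 : (3 : ℤ) ^ a ≤ 3 ^ (9 - 1) := pow_le_pow_right₀ (by norm_num) (by omega)
    push_cast; norm_num at h3 ⊢; nlinarith [h3]
  · push_cast; nlinarith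
  · push_cast; nlinarith [mul_nonneg (sub_nonneg.2 hlo') (by positivity : (0 : ℤ) ≤ (k : ℤ))]

/-- Piece `a₀ = 10` (`6563 ≤ l ≤ 19683`, `l = 2k + 3`) of the cell table below. [cite: Mochizuki2012, IUTchIV Prop. 1.2 (i)(ii) p. 10] -/
private theorem WildUnitCells.p191_10 (k : ℕ) (hlo : 3280 ≤ k) (hhi : k ≤ 9840) :
    (∀ a, a < 10 → (1 : ℤ) * ((3 : ℕ) : ℤ) ^ a * (((3 : ℕ) : ℤ) - 1) < ((12 * k + 18 : ℕ) : ℤ)) ∧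
      ((12 * k + 18 : ℕ) : ℤ) ≤ 1 * ((3 : ℕ) : ℤ) ^ (10 : ℕ) * (((3 : ℕ) : ℤ) - 1) ∧
      ((6 * 30 : ℕ) : ℤ) - (((k : ℕ) : ℤ) + 1 + 1) * (((3 : ℕ) : ℤ) ^ (10 : ℕ) - ((10 : ℕ) : ℤ) * ((12 * k + 18 : ℕ) : ℤ)) <
        ((12 * k + 18 : ℕ) : ℤ) * (((((k : ℕ) : ℤ) + 1) ^ 2 * ((6 * 30 : ℕ) : ℤ) - (((k : ℕ) : ℤ) + 1) * ((16 * k + 23 : ℕ) : ℤ)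
          - (((k : ℕ) : ℤ) + 1 + 1) * ((6 * k + 10 : ℕ) : ℤ)) / ((12 * k + 18 : ℕ) : ℤ)) := by
  have hlo' : (3280 : ℤ) ≤ (k : ℤ) := by exact_mod_cast hlo
  have hhi' : (k : ℤ) ≤ 9840 := by exact_mod_cast hhi
  refine ⟨fun a ha => ?_, ?_, lt_mul_ediv_of_add_le' (by positivity) ?_⟩
  · have h3 : (3 : ℤ) ^ a ≤ 3 ^ (10 - 1) := pow_le_pow_right₀ (by norm_num) (by omega)
    push_cast; norm_num at h3 ⊢; nlinarith [h3]
  · push_cast; nlinarith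
  · push_cast; nlinarith [mul_nonneg (sub_nonneg.2 hlo') (by positivity : (0 : ℤ) ≤ (k : ℤ))]

/-- Piece `a₀ = 11` (`19685 ≤ l ≤ 59049`, `l = 2k + 3`) of the cell table below. [cite: Mochizuki2012, IUTchIV Prop. 1.2 (i)(ii) p. 10] -/
private theorem WildUnitCells.p191_11 (k : ℕ) (hlo : 9841 ≤ k) (hhi : k ≤ 29523) :
    (∀ a, a < 11 → (1 : ℤ) * ((3 : ℕ) : ℤ) ^ a * (((3 : ℕ) : ℤ) - 1) < ((12 * k + 18 : ℕ) : ℤ)) ∧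
      ((12 * k + 18 : ℕ) : ℤ) ≤ 1 * ((3 : ℕ) : ℤ) ^ (11 : ℕ) * (((3 : ℕ) : ℤ) - 1) ∧
      ((6 * 30 : ℕ) : ℤ) - (((k : ℕ) : ℤ) + 1 + 1) * (((3 : ℕ) : ℤ) ^ (11 : ℕ) - ((11 : ℕ) : ℤ) * ((12 * k + 18 : ℕ) : ℤ)) <
        ((12 * k + 18 : ℕ) : ℤ) * (((((k : ℕ) : ℤ) + 1) ^ 2 * ((6 * 30 : ℕ) : ℤ) - (((k : ℕ) : ℤ) + 1) * ((16 * k + 23 : ℕ) : ℤ)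
          - (((k : ℕ) : ℤ) + 1 + 1) * ((6 * k + 10 : ℕ) : ℤ)) / ((12 * k + 18 : ℕ) : ℤ)) := by
  have hlo' : (9841 : ℤ) ≤ (k : ℤ) := by exact_mod_cast hlo
  have hhi' : (k : ℤ) ≤ 29523 := by exact_mod_cast hhi
  refine ⟨fun a ha => ?_, ?_, lt_mul_ediv_of_add_le' (by positivity) ?_⟩
  · have h3 : (3 : ℤ) ^ a ≤ 3 ^ (11 - 1) := pow_le_pow_right₀ (by norm_num) (by omega)
    push_cast; norm_num at h3 ⊢; nlinarith [h3]
  · push_cast; nlinarith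
  · push_cast; nlinarith [mul_nonneg (sub_nonneg.2 hlo') (by positivity : (0 : ℤ) ≤ (k : ℤ))]

/-- Piece `a₀ = 12` (`59051 ≤ l ≤ 177147`, `l = 2k + 3`) of the cell table below. [cite: Mochizuki2012, IUTchIV Prop. 1.2 (i)(ii) p. 10] -/
private theorem WildUnitCells.p191_12 (k : ℕ) (hlo : 29524 ≤ k) (hhi : k ≤ 88572) :
    (∀ a, a < 12 → (1 : ℤ) * ((3 : ℕ) : ℤ) ^ a * (((3 : ℕ) : ℤ) - 1) < ((12 * k + 18 : ℕ) : ℤ)) ∧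
      ((12 * k + 18 : ℕ) : ℤ) ≤ 1 * ((3 : ℕ) : ℤ) ^ (12 : ℕ) * (((3 : ℕ) : ℤ) - 1) ∧
      ((6 * 30 : ℕ) : ℤ) - (((k : ℕ) : ℤ) + 1 + 1) * (((3 : ℕ) : ℤ) ^ (12 : ℕ) - ((12 : ℕ) : ℤ) * ((12 * k + 18 : ℕ) : ℤ)) <
        ((12 * k + 18 : ℕ) : ℤ) * (((((k : ℕ) : ℤ) + 1) ^ 2 * ((6 * 30 : ℕ) : ℤ) - (((k : ℕ) : ℤ) + 1) * ((16 * k + 23 : ℕ) : ℤ)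
          - (((k : ℕ) : ℤ) + 1 + 1) * ((6 * k + 10 : ℕ) : ℤ)) / ((12 * k + 18 : ℕ) : ℤ)) := by
  have hlo' : (29524 : ℤ) ≤ (k : ℤ) := by exact_mod_cast hlo
  have hhi' : (k : ℤ) ≤ 88572 := by exact_mod_cast hhi
  refine ⟨fun a ha => ?_, ?_, lt_mul_ediv_of_add_le' (by positivity) ?_⟩
  · have h3 : (3 : ℤ) ^ a ≤ 3 ^ (12 - 1) := pow_le_pow_right₀ (by norm_num) (by omega)
    push_cast; norm_num at h3 ⊢; nlinarith [h3]
  · push_cast; nlinarith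
  · push_cast; nlinarith [mul_nonneg (sub_nonneg.2 hlo') (by positivity : (0 : ℤ) ≤ (k : ℤ))]

/-- Piece `a₀ = 13` (`177149 ≤ l ≤ 531441`, `l = 2k + 3`) of the cell table below. [cite: Mochizuki2012, IUTchIV Prop. 1.2 (i)(ii) p. 10] -/
private theorem WildUnitCells.p191_13 (k : ℕ) (hlo : 88573 ≤ k) (hhi : k ≤ 265719) :
    (∀ a, a < 13 → (1 : ℤ) * ((3 : ℕ) : ℤ) ^ a * (((3 : ℕ) : ℤ) - 1) < ((12 * k + 18 : ℕ) : ℤ)) ∧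
      ((12 * k + 18 : ℕ) : ℤ) ≤ 1 * ((3 : ℕ) : ℤ) ^ (13 : ℕ) * (((3 : ℕ) : ℤ) - 1) ∧
      ((6 * 30 : ℕ) : ℤ) - (((k : ℕ) : ℤ) + 1 + 1) * (((3 : ℕ) : ℤ) ^ (13 : ℕ) - ((13 : ℕ) : ℤ) * ((12 * k + 18 : ℕ) : ℤ)) <
        ((12 * k + 18 : ℕ) : ℤ) * (((((k : ℕ) : ℤ) + 1) ^ 2 * ((6 * 30 : ℕ) : ℤ) - (((k : ℕ) : ℤ) + 1) * ((16 * k + 23 : ℕ) : ℤ)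
          - (((k : ℕ) : ℤ) + 1 + 1) * ((6 * k + 10 : ℕ) : ℤ)) / ((12 * k + 18 : ℕ) : ℤ)) := by
  have hlo' : (88573 : ℤ) ≤ (k : ℤ) := by exact_mod_cast hlo
  have hhi' : (k : ℤ) ≤ 265719 := by exact_mod_cast hhi
  refine ⟨fun a ha => ?_, ?_, lt_mul_ediv_of_add_le' (by positivity) ?_⟩
  · have h3 : (3 : ℤ) ^ a ≤ 3 ^ (13 - 1) := pow_le_pow_right₀ (by norm_num) (by omega)
    push_cast; norm_num at h3 ⊢; nlinarith [h3]
  · push_cast; nlinarith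
  · push_cast; nlinarith [mul_nonneg (sub_nonneg.2 hlo') (by positivity : (0 : ℤ) ≤ (k : ℤ))]

/-- Piece `a₀ = 14` (`531443 ≤ l ≤ 956537`, `l = 2k + 3`) of the cell table below. [cite: Mochizuki2012, IUTchIV Prop. 1.2 (i)(ii) p. 10] -/
private theorem WildUnitCells.p191_14 (k : ℕ) (hlo : 265720 ≤ k) (hhi : k ≤ 478267) :
    (∀ a, a < 14 → (1 : ℤ) * ((3 : ℕ) : ℤ) ^ a * (((3 : ℕ) : ℤ) - 1) < ((12 * k + 18 : ℕ) : ℤ)) ∧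
      ((12 * k + 18 : ℕ) : ℤ) ≤ 1 * ((3 : ℕ) : ℤ) ^ (14 : ℕ) * (((3 : ℕ) : ℤ) - 1) ∧
      ((6 * 30 : ℕ) : ℤ) - (((k : ℕ) : ℤ) + 1 + 1) * (((3 : ℕ) : ℤ) ^ (14 : ℕ) - ((14 : ℕ) : ℤ) * ((12 * k + 18 : ℕ) : ℤ)) <
        ((12 * k + 18 : ℕ) : ℤ) * (((((k : ℕ) : ℤ) + 1) ^ 2 * ((6 * 30 : ℕ) : ℤ) - (((k : ℕ) : ℤ) + 1) * ((16 * k + 23 : ℕ) : ℤ)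
          - (((k : ℕ) : ℤ) + 1 + 1) * ((6 * k + 10 : ℕ) : ℤ)) / ((12 * k + 18 : ℕ) : ℤ)) := by
  have hlo' : (265720 : ℤ) ≤ (k : ℤ) := by exact_mod_cast hlo
  have hhi' : (k : ℤ) ≤ 478267 := by exact_mod_cast hhi
  refine ⟨fun a ha => ?_, ?_, lt_mul_ediv_of_add_le' (by positivity) ?_⟩
  · have h3 : (3 : ℤ) ^ a ≤ 3 ^ (14 - 1) := pow_le_pow_right₀ (by norm_num) (by omega)
    push_cast; norm_num at h3 ⊢; nlinarith [h3]
  · push_cast; nlinarith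
  · push_cast; nlinarith [mul_nonneg (sub_nonneg.2 hhi') (by positivity : (0 : ℤ) ≤ (k : ℤ))]

/-- **Cell table, 5¹¹·31·191-triple at `p = 3`, EVERY prime `5 ≤ l ≤ 956537`:** at `A = 3·2·(5/gcd(5,30)) = 6` the W2 `δ`-cell (`δ = 8·l − 1`, `r_in = 3l + 1`,
`r_out = 3^{a₀} − 6·a₀·l`, `P_q = 180`, top label) FAILS, with the turning point `a₀ = 3, …, 14` on `l ≤ 3^{a₀−1}`.
[cite: Mochizuki2012, IUTchIV Prop. 1.2 (i)(ii) p. 10] [claim: Mochizuki2012, status: disputed] -/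
theorem WildUnitCells.frey289111328125_three_band {l : ℕ} (hl : l.Prime) (h5 : 5 ≤ l) (hL : l ≤ 956537) :
    ∀ A : ℕ, A = (3 : ℕ) * ((3 : ℕ) - 1) * (5 / Nat.gcd 5 30) →
      ∃ a₀ : ℕ, (∀ a, a < a₀ → (1 : ℤ) * ((3 : ℕ) : ℤ) ^ a * (((3 : ℕ) : ℤ) - 1) < ((A * l : ℕ) : ℤ)) ∧
        ((A * l : ℕ) : ℤ) ≤ 1 * ((3 : ℕ) : ℤ) ^ a₀ * (((3 : ℕ) : ℤ) - 1) ∧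
        ((A * 30 : ℕ) : ℤ) - (((((l - 1) / 2 - 1 : ℕ) : ℕ) : ℤ) + 1 + 1) * (((3 : ℕ) : ℤ) ^ a₀ - (a₀ : ℤ) * ((A * l : ℕ) : ℤ)) <
          ((A * l : ℕ) : ℤ) * (((((((l - 1) / 2 - 1 : ℕ) : ℕ) : ℤ) + 1) ^ 2 * ((A * 30 : ℕ) : ℤ)
            - (((((l - 1) / 2 - 1 : ℕ) : ℕ) : ℤ) + 1) * (((A * l + A * l / (3 : ℕ) - 1 : ℕ) : ℤ))
            - (((((l - 1) / 2 - 1 : ℕ) : ℕ) : ℤ) + 1 + 1) * (((A * l) / ((3 : ℕ) - 1) + 1 : ℕ) : ℤ)) / ((A * l : ℕ) : ℤ)) := by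
  intro A hA
  have hA6 : A = 6 := by rw [hA]; norm_num
  subst hA6
  have hl2 : l ≠ 2 := by omega
  obtain ⟨m, hm⟩ := hl.odd_of_ne_two hl2
  subst hm
  obtain ⟨k, rfl⟩ : ∃ k, m = k + 1 := ⟨m - 1, by omega⟩
  -- normalise the natural-number arithmetic inside the casts
  have e0 : (2 * (k + 1) + 1 - 1) / 2 - 1 = k := by omega
  have e1 : 6 * (2 * (k + 1) + 1) + 6 * (2 * (k + 1) + 1) / (3 : ℕ) - 1 = 16 * k + 23 := by omega
  have e2 : 6 * (2 * (k + 1) + 1) / ((3 : ℕ) - 1) + 1 = 6 * k + 10 := by omega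
  have e3 : 6 * (2 * (k + 1) + 1) = 12 * k + 18 := by ring
  rw [e0, e1, e2, e3]
  by_cases hA3 : k ≤ 3
  · exact ⟨3, WildUnitCells.p191_3 k (by omega) hA3⟩
  by_cases hA4 : k ≤ 12
  · exact ⟨4, WildUnitCells.p191_4 k (by omega) hA4⟩
  by_cases hA5 : k ≤ 39
  · exact ⟨5, WildUnitCells.p191_5 k (by omega) hA5⟩
  by_cases hA6 : k ≤ 120
  · exact ⟨6, WildUnitCells.p191_6 k (by omega) hA6⟩
  by_cases hA7 : k ≤ 363
  · exact ⟨7, WildUnitCells.p191_7 k (by omega) hA7⟩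
  by_cases hA8 : k ≤ 1092
  · exact ⟨8, WildUnitCells.p191_8 k (by omega) hA8⟩
  by_cases hA9 : k ≤ 3279
  · exact ⟨9, WildUnitCells.p191_9 k (by omega) hA9⟩
  by_cases hA10 : k ≤ 9840
  · exact ⟨10, WildUnitCells.p191_10 k (by omega) hA10⟩
  by_cases hA11 : k ≤ 29523
  · exact ⟨11, WildUnitCells.p191_11 k (by omega) hA11⟩
  by_cases hA12 : k ≤ 88572
  · exact ⟨12, WildUnitCells.p191_12 k (by omega) hA12⟩
  by_cases hA13 : k ≤ 265719
  · exact ⟨13, WildUnitCells.p191_13 k (by omega) hA13⟩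
  · exact ⟨14, WildUnitCells.p191_14 k (by omega) (by omega)⟩

/-! ## §2. The band: S_H FAILS at every genuine datum over `(ratPoint (a/c), l)`, every prime `5 ≤ l ≤ 956537` -/

/-- **R-W BAND `pilotDataOfK:frey-289111328125-…:l`, EVERY prime `5 ≤ l ≤ 956537` — REFUTED side, UNCONDITIONALLY, at the WILD pole `p = 3` (type W2 by
theorem: `3 ∣ D`, `9 ∤ D`) of `5¹¹·31·191 + 2⁸·7¹³·89·859² = 3³⁰·13⁴·277`:** for EVERY genuine Θ-volume datum `T` over `(ratPoint (a/c), l)` and EVERY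
choice of the free context binders and Kummer data, the hull-level clause S_H (`Cor312Vol.PilotKummerCompatHull`, chosen realising ideles, pinned reading)
FAILS — W2 engine `GenuineK.not_pilotKummerCompatHull_chosen_triple_of_wildUnitCell` (exact type `e = 6·l`, exact different `δ = 8l − 1`) at the top label
with the symbolic cell table `WildUnitCells.frey289111328125_three_band`; the band ends at `956537` (the certificate fails from `l = 956569`).
NOT claimed: admissibility / Szpiro-badness / (P6) of `(ratPoint (a/c), l)`, non-emptiness of the datum type; refuted-as-typed ≠ refuted-in-print.
[cite: Mochizuki2012, IUTchIII Cor. 3.12 Step (xi-f) p. 184; IUTchIV Prop. 1.2 (i)(ii) p. 10, Prop. 1.3 (i) p. 11] [claim: Mochizuki2012, status: disputed] -/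
theorem GenuineK.not_pilotKummerCompatHull_chosen_frey289111328125_three_band {l : ℕ} (hl : l.Prime) (h5 : 5 ≤ l) (hL : l ≤ 956537)
    (T : Cor22.ThetaVolumeDatumAt (ratPoint (((5 ^ 11 * 31 * 191 : ℕ) : ℚ) / (3 ^ 30 * 13 ^ 4 * 277 : ℕ))) l) :
    letI := T.instFieldF; letI := T.instNumberFieldF; letI := T.instAlgebraF; letI := T.instFieldK
    letI := T.instNumberFieldK; letI := T.instAlgebraK; letI := T.instFieldFbar; letI := T.instAlgebraFbar
    letI := T.instAlgebraKFbar; letI := T.instIsElliptic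
    ∀ (M : Type) [Field M] [NumberField M]
      (archPk : ∀ (j : (thetaIndex (pilotDataOfK T.D T.K)).Label) (vQ : (thetaIndex (pilotDataOfK T.D T.K)).VQ),
        Set ((logShellsDH (pilotDataOfK T.D T.K) (analyticLogv T.K)).Packet j vQ))
      (archSub : ∀ (j : (thetaIndex (pilotDataOfK T.D T.K)).Label) (v : (thetaIndex (pilotDataOfK T.D T.K)).V),
        Set ((logShellsDH (pilotDataOfK T.D T.K) (analyticLogv T.K)).Packet j ((thetaIndex (pilotDataOfK T.D T.K)).over v)))
      (Ψ : ℤ → ∀ v : (thetaIndex (pilotDataOfK T.D T.K)).V, v ∈ (thetaIndex (pilotDataOfK T.D T.K)).Vbad →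
        Set ((logShellsDH (pilotDataOfK T.D T.K) (analyticLogv T.K)).StarPacket v))
      (act : ℤ → ∀ v : (thetaIndex (pilotDataOfK T.D T.K)).V, v ∈ (thetaIndex (pilotDataOfK T.D T.K)).Vbad →
        (logShellsDH (pilotDataOfK T.D T.K) (analyticLogv T.K)).StarPacket v →
          Module.End ℚ ((logShellsDH (pilotDataOfK T.D T.K) (analyticLogv T.K)).StarPacket v))
      (Mmod : ℤ → ∀ j : (thetaIndex (pilotDataOfK T.D T.K)).LabelStar,
        Set ((logShellsDH (pilotDataOfK T.D T.K) (analyticLogv T.K)).GlobalPacket j.1))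
      (region : ℤ → ∀ j : (thetaIndex (pilotDataOfK T.D T.K)).LabelStar, FinDivisor M →
        ∀ vQ : (thetaIndex (pilotDataOfK T.D T.K)).VQ, Set ((logShellsDH (pilotDataOfK T.D T.K) (analyticLogv T.K)).Packet j.1 vQ))
      (frobAdm : ℤ → ℤ → ∀ (j : (thetaIndex (pilotDataOfK T.D T.K)).Label) (vQ : (thetaIndex (pilotDataOfK T.D T.K)).VQ),
        Set ((logShellsDH (pilotDataOfK T.D T.K) (analyticLogv T.K)).Packet j vQ) → Prop)
      (frobLogvol : ℤ → ℤ → ∀ (j : (thetaIndex (pilotDataOfK T.D T.K)).Label) (vQ : (thetaIndex (pilotDataOfK T.D T.K)).VQ),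
        Set ((logShellsDH (pilotDataOfK T.D T.K) (analyticLogv T.K)).Packet j vQ) → ℝ)
      (frobΨ : ℤ → ℤ → ∀ v : (thetaIndex (pilotDataOfK T.D T.K)).V, v ∈ (thetaIndex (pilotDataOfK T.D T.K)).Vbad →
        Set ((logShellsDH (pilotDataOfK T.D T.K) (analyticLogv T.K)).StarPacket v))
      (frobMmod : ℤ → ℤ → ∀ j : (thetaIndex (pilotDataOfK T.D T.K)).LabelStar,
        Set ((logShellsDH (pilotDataOfK T.D T.K) (analyticLogv T.K)).GlobalPacket j.1))
      (unitImage : ℤ → ℤ → ℕ → ∀ (j : (thetaIndex (pilotDataOfK T.D T.K)).Label) (vQ : (thetaIndex (pilotDataOfK T.D T.K)).VQ),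
        Set ((logShellsDH (pilotDataOfK T.D T.K) (analyticLogv T.K)).Packet j vQ))
      (ballImage : ℤ → ℤ → ∀ (j : (thetaIndex (pilotDataOfK T.D T.K)).Label) (vQ : (thetaIndex (pilotDataOfK T.D T.K)).VQ),
        Set ((logShellsDH (pilotDataOfK T.D T.K) (analyticLogv T.K)).Packet j vQ))
      (thetaDiv : ℤ → ℤ → LgpDivisor M (thetaIndex (pilotDataOfK T.D T.K)).lstar)
      (n : ℤ) {HT : Type} {LogLink : HT → HT → Type} {IsFull : ∀ {s t : HT}, LogLink s t → Prop}
      (lat : LGPGaussianLogThetaLattice LogLink IsFull)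
      {Frd : Type} {IsoF : Frd → Frd → Type} {Ob : Frd → Type} {realify : Frd → Frd} {Strip : Type}
      {IsoS : Strip → Strip → Type} {Mv : ∀ v : (thetaIndex (pilotDataOfK T.D T.K)).V, v ∈ (thetaIndex (pilotDataOfK T.D T.K)).Vbad → Type}
      [∀ v h, Monoid (Mv v h)]
      (sig : GlobalLGPFrobenioidSignature (thetaIndex (pilotDataOfK T.D T.K)).lstar (thetaIndex (pilotDataOfK T.D T.K)).V
        (· ∈ (thetaIndex (pilotDataOfK T.D T.K)).Vbad) Frd IsoF Ob realify Strip IsoS Mv)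
      (split : SplittingMonoids Mv) {ObΔ : Type}
      {N : ∀ v : (thetaIndex (pilotDataOfK T.D T.K)).V, v ∈ (thetaIndex (pilotDataOfK T.D T.K)).Vbad → Type}
      [∀ v h, Monoid (N v h)] (qData : QPilotData ObΔ N)
      (qK : ∀ v : (thetaIndex (pilotDataOfK T.D T.K)).V, v ∈ (thetaIndex (pilotDataOfK T.D T.K)).Vbad →
        Set ((logShellsDH (pilotDataOfK T.D T.K) (analyticLogv T.K)).StarPacket v)),
    ¬ Cor312Vol.PilotKummerCompatHull
        (LatticeSituation.ofShells (logShellsDH (pilotDataOfK T.D T.K) (analyticLogv T.K)) M archPk archSub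
          (summandPiecesPr (pilotDataOfK T.D T.K) (logvAnalytic_analyticLogv (F := T.K))).Adm
          (summandPiecesPr (pilotDataOfK T.D T.K) (logvAnalytic_analyticLogv (F := T.K))).logvol Ψ act Mmod region frobAdm
          frobLogvol frobΨ frobMmod unitImage ballImage thetaDiv)
        (settingPrVolSharp (pilotDataOfK T.D T.K) (logvAnalytic_analyticLogv (F := T.K)) M archPk archSub Ψ act Mmod region n
          lat sig split qData (exists_realising_qIdeles_pilotDataOfK T.D).choose (exists_realising_thetaIdeles_pilotDataOfK T.D).choose
          (exists_realising_qIdeles_pilotDataOfK T.D).choose_spec.1 (exists_realising_qIdeles_pilotDataOfK T.D).choose_spec.2.1)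
        (fun _ => Cor312.Setting.qRegion
          (settingPrVolSharp (pilotDataOfK T.D T.K) (logvAnalytic_analyticLogv (F := T.K)) M archPk archSub Ψ act Mmod region n
            lat sig split qData (exists_realising_qIdeles_pilotDataOfK T.D).choose (exists_realising_thetaIdeles_pilotDataOfK T.D).choose
            (exists_realising_qIdeles_pilotDataOfK T.D).choose_spec.1 (exists_realising_qIdeles_pilotDataOfK T.D).choose_spec.2.1))
        qK := by
  have hcells := WildUnitCells.frey289111328125_three_band hl h5 hL
  have hl3 : (3 : ℕ) ≠ l := by omega
  exact GenuineK.not_pilotKummerCompatHull_chosen_triple_of_wildUnitCell (b := 2 ^ 8 * 7 ^ 13 * 89 * 859 ^ 2)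
    isABCTriple_frey289111328125 T ⟨3, by norm_num⟩ (p' := 5) (Or.inl ⟨rfl, rfl⟩) hl3 (t := 30) (by norm_num) (by norm_num)
    (by norm_num) (by norm_num) (by norm_num) (by norm_num) (i := (l - 1) / 2 - 1) (by omega) hcells

end Summit.ABC.IUTFork.Conditional

end
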